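import Literature.Analysis.FluidPDE.EulerFourierGalerkin
import Mathlib.Analysis.ODE.Gronwall
import Mathlib.Analysis.Calculus.Deriv.Inv
import Mathlib.Analysis.Calculus.Deriv.Pow
import HarnessLib

/-!
# Uniform weighted energy estimates for the Fourier–Galerkin system on `ℝ³`
# (Majda–Bertozzi 2002, Prop. 3.7 (3.58), (3.59)–(3.60), (3.79), on the Fourier side)

Third file of the Fourier–Galerkin construction of local smooth solutions of the Euler and
Navier–Stokes equations on `ℝ³` with `H³`-controlled lifespan (discharge of
`Literature.Analysis.FluidPDE.MajdaBertozzi2002_localExistenceH3`, `NSVorticityBKM.lean`;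
A. J. Majda, A. L. Bertozzi, *Vorticity and Incompressible Flow*, CUP 2002, §3.2.3). Majda–Bertozzi
prove the `H^m` energy estimate for the regularised solutions uniformly in the regularisation
(Prop. 3.7, (3.58), p. 105), deduce with the Sobolev inequality the Riccati inequality
`d/dt‖v^ε‖_m ≤ c_m‖v^ε‖²_m` ((3.59), p. 106) and hence the uniform bound
`sup_{0≤t≤T}‖v^ε‖_m ≤ ‖v₀‖_m/(1 − c_mT‖v₀‖_m)` on `T < 1/(c_m‖v₀‖_m)` ((3.60), (3.55)); in the proof
of Thm. 3.6 (p. 117) they note that the same estimate "(3.79) gives an a priori bound for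
`‖v(·,t)‖_m` for all `m ≥ 3`" on the `H³` interval. This file proves the Fourier–Galerkin
counterparts for the global solutions `α : [0,∞) → symSubspace` of `α' = F_R(α)` of
`EulerFourierGalerkin`, uniformly in the cut-off radius `R` and in the heat rate `c = 4π²ν ≥ 0`:

* `truncEnergy m R v = E_m^R(v) = Re ⟪v, M_{θ_m^R} v⟫ = ∫_{‖ξ‖≤R} (1+‖ξ‖)^{2m} ‖v(ξ)‖² dξ`
  (`energySymbol`, `energyCLM`; MB's Sobolev weight (3.29) on the cut-off ball), with
  `E_m^R(v) = ∑_l ‖(1+‖·‖)^m (χ_Rv)_l‖²_{L²}` (`ofReal_truncEnergy_eq_sum_lintegral`) and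
  `E_m^R(v) ≤ ∫⁻ ((1+‖ξ‖)^m‖v(ξ)‖)²` (`ofReal_truncEnergy_le_lintegral`, the untruncated moment of the
  datum, for the solutions do not move off the ball);
* `hasDerivWithinAt_truncEnergy(_galerkin)` — `d/dt E_m^R(α) = 2Re ⟪M α, F_R(α)⟫` (self-adjoint
  multipliers, `inner_symMulCLM_left`);
* `abs_re_inner_energyCLM_galerkinNonlin_le` — **the `H^m` estimate** `|Re ⟪M_{θ_m}v, B_R(v,v)⟫| ≤
  Λ_m (E_3^R)^{1/2} E_m^R` on the phase space, `m ≥ 1`, from the commutator estimate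
  `ofReal_abs_re_integral_weight_sq_nonlin_le` of `EulerFourierTransport`; the `L¹_ξ` moment
  `∫‖ζ‖|v̂(ζ)|` that replaces `|∇v|_{L^∞}` is bounded by `W (E_3^R)^{1/2}`, `W = ‖(1+‖·‖)^{-2}‖_{L²(ℝ³)}`
  (`lintegral_norm_mul_truncCoeff_le`, the role of the Sobolev inequality (3.30) in (3.59));
* `two_mul_re_inner_energyCLM_galerkinField_le` — **`(E_m^R)' ≤ Λ'_m (E_3^R)^{1/2} E_m^R`** for
  `c ≥ 0` (the viscous term has the right sign, `re_inner_energyCLM_viscCLM_nonneg`);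
* `truncEnergy_three_le` — **uniform `H³` bound**: `E_3^R(α(t)) ≤ 4(A+1)` for `t ≤ τ(A)`,
  `τ(A) = lifespan A = 1/(2Λ'_3(A+1)^{1/2})`, whenever `E_3^R(α(0)) ≤ A` (comparison with the strict
  supersolution `(A+1)/(1−μt)²` of `p' = Λ'_3 p^{3/2}`, `le_of_deriv_le_mul_sqrt_mul_self`, via
  Mathlib's `image_le_of_deriv_right_lt_deriv_boundary'`);
* `truncEnergy_le_mul_exp` — **all weighted energies stay bounded on the lifespan**:
  `E_m^R(α(t)) ≤ E_m^R(α(0)) exp(2Λ'_m(A+1)^{1/2} t)`, `m ≥ 1` (Grönwall,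
  `le_gronwallBound_of_liminf_deriv_right_le`).

The constants `W`, `Λ_m = 24π m2^{m-1} W`, `Λ'_m = 2Λ_m + 1`, `τ(A)` are explicit but not optimised
(MB: `T < 1/(c_m‖v₀‖_m)`; here `τ` depends on the bound `A` of the squared weighted `H³` energy
only, as the target fact requires). No facts are introduced; the definitions are the energy symbol
and operator, the energy, and the four real constants.

## Mathlib / tree search

Tree: everything of `EulerFourierGalerkin` and `EulerFourierTransport` listed there;
`majorant_sq_le` (`FourierL2Nonlin`), `sq_lintegral_le_weight`, `lintegral_weight_inv_sq_lt_top`,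
`measurable_ofReal_weight` (`FourierL2Convolution`), `ofReal_norm_mul_weight_pred_le`,
`enorm_ofReal_mul` (`EulerFourierTransport`). The scalar comparison is the pattern of
`KatoLai.le_of_hasDerivWithinAt_of_eq_imp_lt` (`KatoLaiGalerkin`, not imported to keep the import
closure small; Mathlib's `image_le_of_deriv_right_lt_deriv_boundary'` is used directly) and the
Grönwall step that of `NSHopfGalerkinExistence.energy_apriori_bound`. Mathlib:
`ofReal_integral_eq_lintegral_ofReal`, `integral_complex_ofReal`, `MemLp.integrable_norm_pow`,
`HasDerivWithinAt.inner`, `HasDerivAt.fun_pow`, `HasDerivAt.fun_inv`, `gronwallBound_ε0`,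
`ENNReal.rpow_le_rpow`, `ENNReal.mul_rpow_of_nonneg`, `ENNReal.ofReal_rpow_of_nonneg`.

## References

* A. J. Majda, A. L. Bertozzi, *Vorticity and Incompressible Flow*, CUP 2002: (3.29), Lemma 3.3
  (3.30) (p. 97), Thm. 3.4 (3.55)–(3.56) (p. 104), Prop. 3.7 (3.58) (p. 105), (3.59)–(3.60)
  (p. 106), (3.79) and the remark on p. 117. [MajdaBertozzi2002]
-/

noncomputable section

open MeasureTheory Real Set Filter Function Metric
open scoped ENNReal NNReal ComplexConjugate InnerProductSpace
open _root_.Topology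

namespace Literature.Analysis.FluidPDE.FourierNS

/-- Physical/frequency space `ℝ³`. -/
local notation "ℝ³" => EuclideanSpace ℝ (Fin 3)
/-- The fibre `ℂ³` of the coefficient fields. -/
local notation "ℂ³" => EuclideanSpace ℂ (Fin 3)
/-- The Hilbert space `L²(ℝ³; ℂ³)` of Fourier coefficient fields. -/
local notation "𝓗" => Lp (EuclideanSpace ℂ (Fin 3)) 2 (volume : Measure (EuclideanSpace ℝ (Fin 3)))

/-! ### More on symbol multipliers: self-adjointness and composition -/

section SymMul

variable {θ θ' : ℝ³ → ℝ} {C C' : ℝ}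

/-- **Real symbol multipliers are self-adjoint**: `⟪M_θ u, v⟫ = ⟪u, M_θ v⟫`. [folklore] -/
theorem inner_symMulCLM_left (hθm : Measurable θ) (hC : ∀ ξ, |θ ξ| ≤ C) (u v : 𝓗) :
    ⟪symMulCLM θ hθm C hC u, v⟫_ℂ = ⟪u, symMulCLM θ hθm C hC v⟫_ℂ := by
  rw [← inner_conj_symm, inner_symMulCLM, inner_symMulCLM, ← integral_conj]
  refine integral_congr_ae (Eventually.of_forall fun ξ => ?_)
  simp only [map_mul, map_sum, Complex.conj_ofReal, Complex.conj_conj]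
  congr 1
  exact Finset.sum_congr rfl fun l _ => mul_comm _ _

/-- **Composition of symbol multipliers** is the multiplier of the product symbol. [folklore] -/
theorem symMulCLM_symMulCLM (hθm : Measurable θ) (hC : ∀ ξ, |θ ξ| ≤ C) (hθm' : Measurable θ')
    (hC' : ∀ ξ, |θ' ξ| ≤ C') {P : ℝ³ → ℝ} (hPm : Measurable P) {D : ℝ} (hD : ∀ ξ, |P ξ| ≤ D)
    (hP : ∀ ξ, P ξ = θ ξ * θ' ξ) (v : 𝓗) :
    symMulCLM θ hθm C hC (symMulCLM θ' hθm' C' hC' v) = symMulCLM P hPm D hD v := by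
  refine Lp.ext ?_
  filter_upwards [coeFn_symMulCLM hθm hC (symMulCLM θ' hθm' C' hC' v), coeFn_symMulCLM hθm' hC' v,
    coeFn_symMulCLM hPm hD v] with ξ h1 h2 h3
  rw [h1, h2, h3, smul_smul, ← Complex.ofReal_mul, hP]

/-- For two symbols with non-negative product, `Re ⟪M_θ v, M_θ' v⟫ ≥ 0`. [folklore] -/
theorem re_inner_symMulCLM_symMulCLM_nonneg (hθm : Measurable θ) (hC : ∀ ξ, |θ ξ| ≤ C)
    (hθm' : Measurable θ') (hC' : ∀ ξ, |θ' ξ| ≤ C') (h0 : ∀ ξ, 0 ≤ θ ξ * θ' ξ) (v : 𝓗) :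
    0 ≤ (⟪symMulCLM θ hθm C hC v, symMulCLM θ' hθm' C' hC' v⟫_ℂ).re := by
  have hPm : Measurable fun ξ => θ ξ * θ' ξ := hθm.mul hθm'
  have hD : ∀ ξ, |θ ξ * θ' ξ| ≤ C * C' := fun ξ => by
    rw [abs_mul]
    exact mul_le_mul (hC ξ) (hC' ξ) (abs_nonneg _) ((abs_nonneg _).trans (hC ξ))
  rw [inner_symMulCLM_left, symMulCLM_symMulCLM hθm hC hθm' hC' hPm hD (fun _ => rfl)]
  exact re_inner_symMulCLM_self_nonneg _ _ h0 v

end SymMul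

/-! ### The truncated weighted energies `E_m^R(v) = ∫_{‖ξ‖ ≤ R} (1 + ‖ξ‖)^{2m} ‖v(ξ)‖² dξ` -/

section Energy

variable {m : ℕ} {R : ℝ}

/-- Integrability of `θ ‖v‖²` for a bounded measurable symbol `θ` and `v ∈ L²`. [folklore] -/
theorem integrable_symbol_mul_norm_sq {θ : ℝ³ → ℝ} (hθm : Measurable θ) {C : ℝ} (hC : ∀ ξ, |θ ξ| ≤ C)
    (v : 𝓗) : Integrable (fun ξ => θ ξ * ‖(v : ℝ³ → ℂ³) ξ‖ ^ 2) volume := by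
  have h2 : Integrable (fun ξ => ‖(v : ℝ³ → ℂ³) ξ‖ ^ 2) volume := (Lp.memLp v).integrable_norm_pow (by simp)
  refine (h2.const_mul C).mono' (hθm.aestronglyMeasurable.mul h2.1) (Eventually.of_forall fun ξ => ?_)
  rw [Real.norm_eq_abs, abs_mul, abs_of_nonneg (sq_nonneg ‖(v : ℝ³ → ℂ³) ξ‖)]
  exact mul_le_mul_of_nonneg_right (hC ξ) (sq_nonneg _)

/-- The symbol pairing as a real integral: `⟪v, M_θ v⟫ = ∫ θ ‖v(ξ)‖² dξ` (as a complex number).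
[folklore] -/
theorem inner_symMulCLM_self_eq_integral {θ : ℝ³ → ℝ} (hθm : Measurable θ) {C : ℝ}
    (hC : ∀ ξ, |θ ξ| ≤ C) (v : 𝓗) :
    ⟪v, symMulCLM θ hθm C hC v⟫_ℂ = ((∫ ξ, θ ξ * ‖(v : ℝ³ → ℂ³) ξ‖ ^ 2 : ℝ) : ℂ) := by
  rw [inner_symMulCLM, ← integral_complex_ofReal]
  refine integral_congr_ae (Eventually.of_forall fun ξ => ?_)
  have hsum : ∑ l, coeff v ξ l * conj (coeff v ξ l) = ((∑ l, ‖coeff v ξ l‖ ^ 2 : ℝ) : ℂ) := by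
    push_cast
    exact Finset.sum_congr rfl fun l _ => by
      rw [Complex.mul_conj, Complex.normSq_eq_norm_sq]; push_cast; ring
  beta_reduce
  rw [hsum, ← norm_fibre_sq_eq]
  push_cast; ring

/-- The symbol `θ_m^R(ξ) = (1 + ‖ξ‖)^{2m} χ_R(ξ)` of the truncated weighted energy of order `m`
(the Fourier weight of the Sobolev norm (3.29) of Majda–Bertozzi, cut off at radius `R`).
[cite: MajdaBertozzi2002, (3.29) p. 97] -/
def energySymbol (m : ℕ) (R : ℝ) (ξ : ℝ³) : ℝ := ((1 + ‖ξ‖) ^ m) ^ 2 * cutoff R ξ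

/-- Unfolding `energySymbol`. [folklore] -/
theorem energySymbol_apply (m : ℕ) (R : ℝ) (ξ : ℝ³) :
    energySymbol m R ξ = ((1 + ‖ξ‖) ^ m) ^ 2 * cutoff R ξ := rfl

/-- The energy symbol is measurable. [folklore] -/
theorem measurable_energySymbol (m : ℕ) (R : ℝ) : Measurable (energySymbol m R) :=
  (((continuous_const.add continuous_norm).pow m).pow 2).measurable.mul (measurable_cutoff R)

/-- The energy symbol is non-negative. [folklore] -/
theorem energySymbol_nonneg (m : ℕ) (R : ℝ) (ξ : ℝ³) : 0 ≤ energySymbol m R ξ :=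
  mul_nonneg (sq_nonneg _) (cutoff_nonneg R ξ)

/-- The energy symbol is bounded by `(1 + max(R,0))^{2m}`. [folklore] -/
theorem abs_energySymbol_le (m : ℕ) (R : ℝ) (ξ : ℝ³) :
    |energySymbol m R ξ| ≤ ((1 + max R 0) ^ m) ^ 2 := by
  rw [abs_of_nonneg (energySymbol_nonneg m R ξ), energySymbol_apply]
  rcases le_or_gt ‖ξ‖ R with h | h
  · rw [cutoff_of_le h, mul_one]
    gcongr
    exact h.trans (le_max_left _ _)
  · rw [cutoff_of_lt h, mul_zero]; positivity

/-- The energy symbol is even. [folklore] -/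
theorem energySymbol_neg (m : ℕ) (R : ℝ) (ξ : ℝ³) : energySymbol m R (-ξ) = energySymbol m R ξ := by
  simp only [energySymbol_apply, norm_neg, cutoff_neg]

/-- **The truncated weighted energy operator** `M_{θ_m^R}` on `L²(ℝ³; ℂ³)`. [folklore] -/
def energyCLM (m : ℕ) (R : ℝ) : 𝓗 →L[ℝ] 𝓗 :=
  symMulCLM (energySymbol m R) (measurable_energySymbol m R) (((1 + max R 0) ^ m) ^ 2)
    (abs_energySymbol_le m R)

/-- **The truncated weighted energy** `E_m^R(v) = Re ⟪v, M_{θ_m^R} v⟫ = ∫_{‖ξ‖≤R} (1+‖ξ‖)^{2m} ‖v(ξ)‖²`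
(the square of Majda–Bertozzi's `‖·‖_m` norm (3.29), restricted to the cut-off ball). [cite: MajdaBertozzi2002, (3.29) p. 97] -/
def truncEnergy (m : ℕ) (R : ℝ) (v : 𝓗) : ℝ := (⟪v, energyCLM m R v⟫_ℂ).re

/-- `E_m^R(v) = ∫ θ_m^R ‖v(ξ)‖²`. [folklore] -/
theorem truncEnergy_eq_integral (m : ℕ) (R : ℝ) (v : 𝓗) :
    truncEnergy m R v = ∫ ξ, energySymbol m R ξ * ‖(v : ℝ³ → ℂ³) ξ‖ ^ 2 := by
  rw [truncEnergy, energyCLM, inner_symMulCLM_self_eq_integral, Complex.ofReal_re]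

/-- `E_m^R(v) ≥ 0`. [folklore] -/
theorem truncEnergy_nonneg (m : ℕ) (R : ℝ) (v : 𝓗) : 0 ≤ truncEnergy m R v :=
  re_inner_symMulCLM_self_nonneg _ _ (energySymbol_nonneg m R) v

/-- The energy operator is self-adjoint. [folklore] -/
theorem inner_energyCLM_left (m : ℕ) (R : ℝ) (u v : 𝓗) :
    ⟪energyCLM m R u, v⟫_ℂ = ⟪u, energyCLM m R v⟫_ℂ :=
  inner_symMulCLM_left _ _ u v

/-- **`E_m^R` in components of the truncated field**:
`E_m^R(v) = ∑_l ∫⁻ ((1+‖ξ‖)^m ‖(χ_R v)_l(ξ)‖)²` (as extended reals). [folklore] -/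
theorem ofReal_truncEnergy_eq_sum_lintegral (m : ℕ) (R : ℝ) (v : 𝓗) :
    ENNReal.ofReal (truncEnergy m R v) =
      ∑ l, ∫⁻ ξ, (ENNReal.ofReal ((1 + ‖ξ‖) ^ m) * ‖truncCoeff R v ξ l‖ₑ) ^ 2 := by
  rw [truncEnergy_eq_integral, ofReal_integral_eq_lintegral_ofReal
    (integrable_symbol_mul_norm_sq (measurable_energySymbol m R) (abs_energySymbol_le m R) v)
    (Eventually.of_forall fun ξ => mul_nonneg (energySymbol_nonneg m R ξ) (sq_nonneg _))]
  rw [← lintegral_finsetSum' _ fun l _ => ?_]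
  · refine lintegral_congr fun ξ => ?_
    rw [norm_fibre_sq_eq, Finset.mul_sum, ENNReal.ofReal_sum_of_nonneg fun l _ =>
      mul_nonneg (energySymbol_nonneg m R ξ) (sq_nonneg _)]
    refine Finset.sum_congr rfl fun l _ => ?_
    have h0 : 0 ≤ (1 + ‖ξ‖) ^ m * (cutoff R ξ * ‖coeff v ξ l‖) :=
      mul_nonneg (by positivity) (mul_nonneg (cutoff_nonneg R ξ) (norm_nonneg _))
    rw [energySymbol_apply, truncCoeff_apply, enorm_ofReal_mul (cutoff_nonneg R ξ),
      ← ofReal_norm (coeff v ξ l), ← ENNReal.ofReal_mul (cutoff_nonneg R ξ),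
      ← ENNReal.ofReal_mul (by positivity : (0 : ℝ) ≤ (1 + ‖ξ‖) ^ m), ← ENNReal.ofReal_pow h0]
    congr 1
    have hc : cutoff R ξ * cutoff R ξ = cutoff R ξ := cutoff_mul_self R ξ
    calc ((1 + ‖ξ‖) ^ m) ^ 2 * cutoff R ξ * ‖coeff v ξ l‖ ^ 2
        = ((1 + ‖ξ‖) ^ m) ^ 2 * (cutoff R ξ * cutoff R ξ) * ‖coeff v ξ l‖ ^ 2 := by rw [hc]
      _ = ((1 + ‖ξ‖) ^ m * (cutoff R ξ * ‖coeff v ξ l‖)) ^ 2 := by ring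
  · exact (((measurable_ofReal_weight m).aemeasurable).mul
      (aesm_apply (aestronglyMeasurable_truncCoeff R v) l).enorm).pow_const _

/-- Each component moment of the truncated field is bounded by the energy:
`∫⁻ ((1+‖ξ‖)^m ‖(χ_R v)_l‖)² ≤ E_m^R(v)`. [folklore] -/
theorem lintegral_weight_truncCoeff_sq_le (m : ℕ) (R : ℝ) (v : 𝓗) (l : Fin 3) :
    ∫⁻ ξ, (ENNReal.ofReal ((1 + ‖ξ‖) ^ m) * ‖truncCoeff R v ξ l‖ₑ) ^ 2 ≤
      ENNReal.ofReal (truncEnergy m R v) := by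
  rw [ofReal_truncEnergy_eq_sum_lintegral]
  exact Finset.single_le_sum (f := fun l => ∫⁻ ξ, (ENNReal.ofReal ((1 + ‖ξ‖) ^ m) *
    ‖truncCoeff R v ξ l‖ₑ) ^ 2) (fun _ _ => zero_le) (Finset.mem_univ l)

/-- **The energy bound by the untruncated moment**: `E_m^R(v) ≤ ∫⁻ ((1+‖ξ‖)^m ‖v(ξ)‖)²`
(possibly infinite right-hand side; finite for data of Sobolev class). [folklore] -/
theorem ofReal_truncEnergy_le_lintegral (m : ℕ) (R : ℝ) (v : 𝓗) :
    ENNReal.ofReal (truncEnergy m R v) ≤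
      ∫⁻ ξ, (ENNReal.ofReal ((1 + ‖ξ‖) ^ m) * ‖(v : ℝ³ → ℂ³) ξ‖ₑ) ^ 2 := by
  rw [truncEnergy_eq_integral, ofReal_integral_eq_lintegral_ofReal
    (integrable_symbol_mul_norm_sq (measurable_energySymbol m R) (abs_energySymbol_le m R) v)
    (Eventually.of_forall fun ξ => mul_nonneg (energySymbol_nonneg m R ξ) (sq_nonneg _))]
  refine lintegral_mono fun ξ => ?_
  rw [energySymbol_apply, ← ofReal_norm, ← ENNReal.ofReal_mul (by positivity),
    ← ENNReal.ofReal_pow (by positivity)]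
  refine ENNReal.ofReal_le_ofReal ?_
  rw [mul_pow]
  exact mul_le_mul_of_nonneg_right (mul_le_of_le_one_right (sq_nonneg _) (cutoff_le_one R ξ))
    (sq_nonneg _)

/-- **Differentiation of the energy along a trajectory**: if `β` has derivative `F` then
`d/dt E_m^R(β) = 2 Re ⟪M β, F⟫` (the multiplier is self-adjoint). [folklore] -/
theorem hasDerivWithinAt_truncEnergy {s : Set ℝ} {β : ℝ → 𝓗} {F : 𝓗} {t : ℝ}
    (hβ : HasDerivWithinAt β F s t) :
    HasDerivWithinAt (fun τ => truncEnergy m R (β τ))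
      (2 * (⟪energyCLM m R (β t), F⟫_ℂ).re) s t := by
  have h1 := hβ.inner ℂ ((energyCLM m R).hasFDerivAt.comp_hasDerivWithinAt t hβ)
  have h2 := Complex.reCLM.hasFDerivAt.comp_hasDerivWithinAt t h1
  have h3 : (⇑Complex.reCLM ∘ fun τ => ⟪β τ, (⇑(energyCLM m R) ∘ β) τ⟫_ℂ) =
      fun τ => truncEnergy m R (β τ) := by
    funext τ; rfl
  rw [h3] at h2
  refine h2.congr_deriv ?_
  simp only [Complex.reCLM_apply, Complex.add_re, Function.comp_apply]
  rw [← inner_energyCLM_left, ← inner_conj_symm F (energyCLM m R (β t)), Complex.conj_re]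
  ring

/-- **The weighted pairing of the Galerkin nonlinearity**:
`⟪M_{θ_m} v, B_R(v, v)⟫ = ∫ ∑_l ρ_m(ξ)² N(χ_Rv, χ_Rv)(ξ)_l conj (χ_Rv)_l(ξ) dξ`, `ρ_m = (1+‖·‖)^m` — the
quantity estimated by `ofReal_abs_re_integral_weight_sq_nonlin_le`. [folklore] -/
theorem inner_energyCLM_galerkinNonlin (m : ℕ) (R : ℝ) (v : 𝓗) :
    ⟪energyCLM m R v, galerkinNonlin R v v⟫_ℂ =
      ∫ ξ, ∑ l, (((1 + ‖ξ‖) ^ m : ℝ) : ℂ) ^ 2 *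
        (nonlin (truncCoeff R v) (truncCoeff R v) ξ l * conj (truncCoeff R v ξ l)) := by
  rw [inner_galerkinNonlin]
  refine integral_congr_ae ?_
  have hc : ∀ᵐ ξ ∂(volume : Measure ℝ³), ∀ l,
      coeff (energyCLM m R v) ξ l = ((energySymbol m R ξ : ℝ) : ℂ) * coeff v ξ l :=
    coeff_symMulCLM_ae (measurable_energySymbol m R) (abs_energySymbol_le m R) v
  filter_upwards [hc] with ξ hξ
  refine Finset.sum_congr rfl fun l _ => ?_
  rw [truncCoeff_apply, hξ l, energySymbol_apply, truncCoeff_apply]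
  simp only [map_mul, Complex.conj_ofReal]
  push_cast
  have hc : (cutoff R ξ : ℂ) * (cutoff R ξ : ℂ) = cutoff R ξ := by
    rw [← Complex.ofReal_mul, cutoff_mul_self]
  calc nonlin (truncCoeff R v) (truncCoeff R v) ξ l *
        ((cutoff R ξ : ℂ) * (((1 + ‖ξ‖ : ℂ) ^ m) ^ 2 * (cutoff R ξ : ℂ) * conj (coeff v ξ l)))
      = ((1 + ‖ξ‖ : ℂ) ^ m) ^ 2 * (nonlin (truncCoeff R v) (truncCoeff R v) ξ l *
          (((cutoff R ξ : ℂ) * (cutoff R ξ : ℂ)) * conj (coeff v ξ l))) := by ring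
    _ = _ := by rw [hc]

/-- The viscous term has the right sign in every weighted energy: `Re ⟪M_{θ_m} v, ‖ξ‖²χ_R v⟫ ≥ 0`.
[folklore] -/
theorem re_inner_energyCLM_viscCLM_nonneg (m : ℕ) (R : ℝ) (v : 𝓗) :
    0 ≤ (⟪energyCLM m R v, viscCLM R v⟫_ℂ).re :=
  re_inner_symMulCLM_symMulCLM_nonneg _ _ _ _
    (fun ξ => mul_nonneg (energySymbol_nonneg m R ξ) (viscSymbol_nonneg R ξ)) v

/-- **The weighted energy balance of the Galerkin field**: for `c ≥ 0`,
`Re ⟪M_{θ_m} v, F_R(v)⟫ ≤ |Re ⟪M_{θ_m} v, B_R(v, v)⟫|` (the viscous term is dropped, as in the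
Euler case of Majda–Bertozzi (3.58)). [cite: MajdaBertozzi2002, Prop. 3.7 (3.58) p. 105] -/
theorem re_inner_energyCLM_galerkinField_le {c : ℝ} (hc : 0 ≤ c) (m : ℕ) (R : ℝ) (v : symSubspace) :
    (⟪energyCLM m R (v : 𝓗), (galerkinField c R v : 𝓗)⟫_ℂ).re ≤
      |(⟪energyCLM m R (v : 𝓗), galerkinNonlin R (v : 𝓗) (v : 𝓗)⟫_ℂ).re| := by
  rw [coe_galerkinField, inner_sub_right, inner_neg_right, inner_smul_right_eq_smul, Complex.sub_re,
    Complex.neg_re, Complex.smul_re, smul_eq_mul]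
  have h1 := re_inner_energyCLM_viscCLM_nonneg m R (v : 𝓗)
  have h2 := neg_abs_le (⟪energyCLM m R (v : 𝓗), galerkinNonlin R (v : 𝓗) (v : 𝓗)⟫_ℂ).re
  nlinarith

end Energy

/-! ### The `H^m` estimate in terms of the energies -/

section Estimate

variable {m : ℕ} {R : ℝ}

/-- `(a^{1/2})² = a` in `ℝ≥0∞` (cf. the lemma of the same content in
`NSRegFourierDuhamel`, not imported). [folklore] -/
theorem energy_rpow_half_sq (a : ℝ≥0∞) : (a ^ (1 / 2 : ℝ)) ^ 2 = a := by
  rw [← ENNReal.rpow_natCast, ← ENNReal.rpow_mul]; norm_num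

/-- `a^{1/2} a^{1/2} = a` in `ℝ≥0∞` (local copy, cf. `rpow_half_mul_rpow_half` of `FourierL2PicardBounds`,
not imported). [folklore] -/
theorem energy_rpow_half_mul_self (a : ℝ≥0∞) : a ^ (1 / 2 : ℝ) * a ^ (1 / 2 : ℝ) = a := by
  rw [← sq, energy_rpow_half_sq]

/-- `(a²)^{1/2} = a` in `ℝ≥0∞` (cf. the lemma of the same content in
`NSRegFourierDuhamel`, not imported). [folklore] -/
theorem energy_sq_rpow_half (a : ℝ≥0∞) : (a ^ 2) ^ (1 / 2 : ℝ) = a := by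
  rw [← ENNReal.rpow_natCast, ← ENNReal.rpow_mul]; norm_num

/-- From `T² ≤ B` to `T ≤ B^{1/2}` in `ℝ≥0∞` (local copy, cf. `y6_le_rpow_half_of_sq_le` of
`TaoY6LocalRMS`, not imported). [folklore] -/
theorem energy_le_rpow_half_of_sq_le {T B : ℝ≥0∞} (h : T ^ 2 ≤ B) : T ≤ B ^ (1 / 2 : ℝ) :=
  calc T = (T ^ 2) ^ (1 / 2 : ℝ) := (energy_sq_rpow_half T).symm
    _ ≤ B ^ (1 / 2 : ℝ) := ENNReal.rpow_le_rpow h (by norm_num)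

/-- The Sobolev constant of the `L¹`-by-weighted-`L²` bound in dimension three:
`W = ‖(1 + ‖·‖)^{-2}‖_{L²(ℝ³)}` (finite, `4 > 3`). [folklore] -/
def weightConstENNReal : ℝ≥0∞ :=
  (∫⁻ ξ : ℝ³, ((ENNReal.ofReal ((1 + ‖ξ‖) ^ 2))⁻¹) ^ 2) ^ (1 / 2 : ℝ)

/-- `W < ∞`. [folklore] -/
theorem weightConstENNReal_lt_top : weightConstENNReal < ⊤ :=
  ENNReal.rpow_lt_top_of_nonneg (by norm_num)
    (lintegral_weight_inv_sq_lt_top (ι := Fin 3) (m := 2) (by simp)).ne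

/-- The real Sobolev constant `W`. [folklore] -/
def weightConst : ℝ := weightConstENNReal.toReal

/-- `0 ≤ W`. [folklore] -/
theorem weightConst_nonneg : 0 ≤ weightConst := ENNReal.toReal_nonneg

/-- `ofReal W = W`. [folklore] -/
theorem ofReal_weightConst : ENNReal.ofReal weightConst = weightConstENNReal :=
  ENNReal.ofReal_toReal weightConstENNReal_lt_top.ne

/-- **Weighted `L¹` by weighted `L²`** (Cauchy–Schwarz with `(1+‖·‖)^{-2} ∈ L²(ℝ³)`): for the
truncated field, `∫⁻ ‖ζ‖ ‖(χ_Rv)_l(ζ)‖ ≤ W · (E_3^R(v))^{1/2}` — the `L¹_ξ` moment that replaces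
`|∇v|_{L^∞}` is controlled by the `H³` energy (Majda–Bertozzi (3.59): the Sobolev inequality
(3.30) bounding `|∇J_εv^ε|_{L^∞}` by `‖v^ε‖_m`, `m > N/2 + 1`). [cite: MajdaBertozzi2002, (3.59) p. 106 with Lemma 3.3 (3.30) p. 97] -/
theorem lintegral_norm_mul_truncCoeff_le (R : ℝ) (v : 𝓗) (l : Fin 3) :
    ∫⁻ ζ, ENNReal.ofReal ‖ζ‖ * ‖truncCoeff R v ζ l‖ₑ ≤
      weightConstENNReal * ENNReal.ofReal (truncEnergy 3 R v) ^ (1 / 2 : ℝ) := by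
  set Φ : ℝ³ → ℝ≥0∞ := fun ζ => ENNReal.ofReal ‖ζ‖ * ‖truncCoeff R v ζ l‖ₑ with hΦ
  have hΦm : AEMeasurable Φ volume :=
    (ENNReal.continuous_ofReal.measurable.comp continuous_norm.measurable).aemeasurable.mul
      (aesm_apply (aestronglyMeasurable_truncCoeff R v) l).enorm
  have h1 := sq_lintegral_le_weight hΦm 2
  have h2 : ∫⁻ ζ, (ENNReal.ofReal ((1 + ‖ζ‖) ^ 2) * Φ ζ) ^ 2 ≤ ENNReal.ofReal (truncEnergy 3 R v) := by
    refine (lintegral_mono fun ζ => ?_).trans (lintegral_weight_truncCoeff_sq_le 3 R v l)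
    rw [hΦ, ← mul_assoc]
    gcongr
    rw [← ENNReal.ofReal_mul (by positivity)]
    refine ENNReal.ofReal_le_ofReal ?_
    calc (1 + ‖ζ‖) ^ 2 * ‖ζ‖ ≤ (1 + ‖ζ‖) ^ 2 * (1 + ‖ζ‖) := by gcongr; linarith [norm_nonneg ζ]
      _ = (1 + ‖ζ‖) ^ 3 := by ring
  calc ∫⁻ ζ, Φ ζ ≤ ((∫⁻ ξ : ℝ³, ((ENNReal.ofReal ((1 + ‖ξ‖) ^ 2))⁻¹) ^ 2) *
        ENNReal.ofReal (truncEnergy 3 R v)) ^ (1 / 2 : ℝ) :=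
        energy_le_rpow_half_of_sq_le (h1.trans (mul_le_mul_right h2 _))
    _ = weightConstENNReal * ENNReal.ofReal (truncEnergy 3 R v) ^ (1 / 2 : ℝ) := by
        rw [ENNReal.mul_rpow_of_nonneg _ _ (by norm_num), weightConstENNReal]

/-- **The commutator constant** `Λ_m = 24π · m 2^{m-1} · W` of the Fourier-side `H^m` estimate.
[folklore] -/
def commConst (m : ℕ) : ℝ := 24 * π * (m * 2 ^ (m - 1)) * weightConst

/-- `0 ≤ Λ_m`. [folklore] -/
theorem commConst_nonneg (m : ℕ) : 0 ≤ commConst m := by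
  unfold commConst; have := weightConst_nonneg; positivity

/-- **The `H^m` energy estimate for the Galerkin nonlinearity** (Majda–Bertozzi 2002, Prop. 3.7,
(3.58) with (3.59): `½ d/dt‖v^ε‖²_m ≤ c_m|∇J_εv^ε|_{L^∞}‖v^ε‖²_m ≤ c_m‖v^ε‖_{m₀}‖v^ε‖²_m`, uniformly
in the regularisation): for `v` in the phase space and `m ≥ 1`,
`|Re ⟪M_{θ_m} v, B_R(v, v)⟫| ≤ Λ_m (E_3^R(v))^{1/2} E_m^R(v)`, uniformly in `R` (and in the viscosity,
which does not enter). Proof: `ofReal_abs_re_integral_weight_sq_nonlin_le` for the truncated field,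
whose right-hand side is bounded by the energies through Cauchy–Schwarz
(`lintegral_norm_mul_truncCoeff_le`, `majorant_sq_le`). [cite: MajdaBertozzi2002, Prop. 3.7 (3.58) p. 105 and (3.59) p. 106] -/
theorem abs_re_inner_energyCLM_galerkinNonlin_le (hm : 1 ≤ m) (R : ℝ) {v : 𝓗} (hv : v ∈ symSubspace) :
    |(⟪energyCLM m R v, galerkinNonlin R v v⟫_ℂ).re| ≤
      commConst m * Real.sqrt (truncEnergy 3 R v) * truncEnergy m R v := by
  set f : ℝ³ → Fin 3 → ℂ := truncCoeff R v with hf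
  -- the quantities of the `H^m` estimate
  set E3 : ℝ≥0∞ := ENNReal.ofReal (truncEnergy 3 R v) with hE3
  set Em : ℝ≥0∞ := ENNReal.ofReal (truncEnergy m R v) with hEm
  set g : Fin 3 → ℝ³ → ℝ≥0∞ := fun k ξ => (ENNReal.ofReal ((1 + ‖ξ‖) ^ m) * ‖f ξ k‖ₑ) ^ 2 with hg
  set X : Fin 3 → ℝ≥0∞ := fun k => (∫⁻ ξ, g k ξ) ^ (1 / 2 : ℝ) with hX
  set Y : Fin 3 → ℝ≥0∞ := fun k => (∫⁻ η, (ENNReal.ofReal ‖η‖ * ENNReal.ofReal ((1 + ‖η‖) ^ (m - 1)) *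
    ‖f η k‖ₑ) ^ 2) ^ (1 / 2 : ℝ) with hY
  set Vn1 : ℝ≥0∞ := ∫⁻ ζ, ENNReal.ofReal ‖ζ‖ * ∑ j, ‖f ζ j‖ₑ with hVn1
  set Vw2 : ℝ≥0∞ := (∫⁻ ζ, (ENNReal.ofReal ((1 + ‖ζ‖) ^ m) * ∑ j, ‖f ζ j‖ₑ) ^ 2) ^ (1 / 2 : ℝ) with hVw2
  set Gn1 : Fin 3 → ℝ≥0∞ := fun k => ∫⁻ η, ENNReal.ofReal ‖η‖ * ‖f η k‖ₑ with hGn1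
  set W : ℝ≥0∞ := weightConstENNReal with hW
  set K : ℝ≥0∞ := (m * 2 ^ (m - 1) : ℝ≥0∞) with hK
  -- measurability
  have hfk : ∀ k, AEStronglyMeasurable (fun ξ => f ξ k) volume := fun k =>
    aesm_apply (aestronglyMeasurable_truncCoeff R v) k
  have hn : Measurable fun η : ℝ³ => ENNReal.ofReal ‖η‖ :=
    ENNReal.continuous_ofReal.measurable.comp continuous_norm.measurable
  -- energies in components
  have hEm_sum : ∑ k, ∫⁻ ξ, g k ξ = Em := (ofReal_truncEnergy_eq_sum_lintegral m R v).symm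
  have hXX : ∀ k, X k * X k = ∫⁻ ξ, g k ξ := fun k => energy_rpow_half_mul_self _
  have hX_le : ∀ k, X k ≤ Em ^ (1 / 2 : ℝ) := fun k =>
    ENNReal.rpow_le_rpow (lintegral_weight_truncCoeff_sq_le m R v k) (by norm_num)
  -- (B1) `Y_k ≤ X_k`
  have hY_le : ∀ k, Y k ≤ X k := fun k => by
    refine ENNReal.rpow_le_rpow (lintegral_mono fun η => ?_) (by norm_num)
    simp only [hg]
    gcongr
    exact ofReal_norm_mul_weight_pred_le hm η
  -- (B2)/(B3) the `L¹` moments by `E_3`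
  have hGn1_le : ∀ k, Gn1 k ≤ W * E3 ^ (1 / 2 : ℝ) := fun k => lintegral_norm_mul_truncCoeff_le R v k
  have hVn1_le : Vn1 ≤ 3 * (W * E3 ^ (1 / 2 : ℝ)) := by
    have h1 : Vn1 = ∑ j, Gn1 j := by
      simp only [hVn1, hGn1, Finset.mul_sum]
      exact lintegral_finsetSum' _ fun j _ => hn.aemeasurable.mul (hfk j).enorm
    rw [h1]
    calc ∑ j, Gn1 j ≤ ∑ _j : Fin 3, W * E3 ^ (1 / 2 : ℝ) := Finset.sum_le_sum fun j _ => hGn1_le j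
      _ = 3 * (W * E3 ^ (1 / 2 : ℝ)) := by simp
  -- (B4) `‖ρ_m V‖₂ ≤ 3 E_m^{1/2}`
  have hVw2_le : Vw2 ≤ 3 * Em ^ (1 / 2 : ℝ) := by
    have h1 : ∫⁻ ζ, (ENNReal.ofReal ((1 + ‖ζ‖) ^ m) * ∑ j, ‖f ζ j‖ₑ) ^ 2 ≤ 3 * Em := by
      calc ∫⁻ ζ, (ENNReal.ofReal ((1 + ‖ζ‖) ^ m) * ∑ j, ‖f ζ j‖ₑ) ^ 2
          ≤ ∫⁻ ζ, 3 * ∑ j, g j ζ := by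
            refine lintegral_mono fun ζ => ?_
            rw [mul_pow]
            calc ENNReal.ofReal ((1 + ‖ζ‖) ^ m) ^ 2 * (∑ j, ‖f ζ j‖ₑ) ^ 2
                ≤ ENNReal.ofReal ((1 + ‖ζ‖) ^ m) ^ 2 * ((Fintype.card (Fin 3) : ℝ≥0∞) *
                    ∑ j, ‖f ζ j‖ₑ ^ 2) := by gcongr; exact majorant_sq_le f ζ
              _ = 3 * ∑ j, g j ζ := by
                  simp only [Fintype.card_fin, Nat.cast_ofNat, hg, Finset.mul_sum, mul_pow]
                  exact Finset.sum_congr rfl fun j _ => by ring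
        _ = 3 * ∑ j, ∫⁻ ζ, g j ζ := by
            rw [lintegral_const_mul' _ _ (by simp), lintegral_finsetSum' _ fun j _ => ?_]
            exact (((measurable_ofReal_weight m).aemeasurable).mul (hfk j).enorm).pow_const _
        _ = 3 * Em := by rw [hEm_sum]
    calc Vw2 ≤ (3 * Em) ^ (1 / 2 : ℝ) := ENNReal.rpow_le_rpow h1 (by norm_num)
      _ = (3 : ℝ≥0∞) ^ (1 / 2 : ℝ) * Em ^ (1 / 2 : ℝ) := ENNReal.mul_rpow_of_nonneg _ _ (by norm_num)
      _ ≤ 3 * Em ^ (1 / 2 : ℝ) := by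
          gcongr
          calc (3 : ℝ≥0∞) ^ (1 / 2 : ℝ) ≤ (3 : ℝ≥0∞) ^ (1 : ℝ) :=
                ENNReal.rpow_le_rpow_of_exponent_le (by norm_num) (by norm_num)
            _ = 3 := ENNReal.rpow_one _
  -- the `H^m` estimate of `EulerFourierTransport`
  have hmain := ofReal_abs_re_integral_weight_sq_nonlin_le (ι := Fin 3) (m := m)
    (aestronglyMeasurable_truncCoeff R v) (aestronglyMeasurable_truncCoeff R v)
    (truncCoeff_divFree_ae R hv) (truncCoeff_conjSymm_ae R hv) (truncCoeff_divFree_ae R hv)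
    (integrable_truncCoeff R v) (memLp_truncCoeff R v)
    (fun k => memLp_weight_mul_truncCoeff (w := fun η : ℝ³ => (1 + ‖η‖) ^ (m + 1)) (by fun_prop)
      (B := (1 + max R 0) ^ (m + 1)) (fun ξ hξ => by
        rw [abs_of_nonneg (by positivity)]; gcongr; exact hξ.trans (le_max_left _ _)) v k)
    ?_ ?_ ?_
  rotate_left
  · -- `hVn1`: finiteness of the `L¹` moment
    refine lt_of_le_of_lt hVn1_le (ENNReal.mul_lt_top (by simp) (ENNReal.mul_lt_top
      weightConstENNReal_lt_top (ENNReal.rpow_lt_top_of_nonneg (by norm_num) ENNReal.ofReal_ne_top)))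
  · -- `hVw2`
    have : (∫⁻ ζ, (ENNReal.ofReal ((1 + ‖ζ‖) ^ m) * ∑ j, ‖f ζ j‖ₑ) ^ 2) = Vw2 ^ 2 := (energy_rpow_half_sq _).symm
    rw [this]
    refine ENNReal.pow_lt_top (lt_of_le_of_lt hVw2_le (ENNReal.mul_lt_top (by simp)
      (ENNReal.rpow_lt_top_of_nonneg (by norm_num) ENNReal.ofReal_ne_top)))
  · -- `hGn1`
    exact fun k => lt_of_le_of_lt (hGn1_le k) (ENNReal.mul_lt_top weightConstENNReal_lt_top
      (ENNReal.rpow_lt_top_of_nonneg (by norm_num) ENNReal.ofReal_ne_top))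
  rw [inner_energyCLM_galerkinNonlin]
  -- bound the right-hand side of the `H^m` estimate by the energies
  have hsum : ∑ k, (X k * Y k * Vn1 + X k * Vw2 * Gn1 k) ≤ 12 * (W * E3 ^ (1 / 2 : ℝ)) * Em := by
    have h1 : ∀ k, X k * Y k * Vn1 ≤ 3 * (W * E3 ^ (1 / 2 : ℝ)) * ∫⁻ ξ, g k ξ := fun k => by
      calc X k * Y k * Vn1 ≤ X k * X k * (3 * (W * E3 ^ (1 / 2 : ℝ))) := by gcongr; exact hY_le k
        _ = 3 * (W * E3 ^ (1 / 2 : ℝ)) * ∫⁻ ξ, g k ξ := by rw [hXX]; ring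
    have h2 : ∀ k, X k * Vw2 * Gn1 k ≤ 3 * (W * E3 ^ (1 / 2 : ℝ)) * Em := fun k => by
      calc X k * Vw2 * Gn1 k ≤ Em ^ (1 / 2 : ℝ) * (3 * Em ^ (1 / 2 : ℝ)) * (W * E3 ^ (1 / 2 : ℝ)) := by
            gcongr
            · exact hX_le k
            · exact hGn1_le k
        _ = 3 * (W * E3 ^ (1 / 2 : ℝ)) * (Em ^ (1 / 2 : ℝ) * Em ^ (1 / 2 : ℝ)) := by ring
        _ = 3 * (W * E3 ^ (1 / 2 : ℝ)) * Em := by rw [energy_rpow_half_mul_self]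
    calc ∑ k, (X k * Y k * Vn1 + X k * Vw2 * Gn1 k)
        ≤ ∑ k, (3 * (W * E3 ^ (1 / 2 : ℝ)) * (∫⁻ ξ, g k ξ) + 3 * (W * E3 ^ (1 / 2 : ℝ)) * Em) :=
          Finset.sum_le_sum fun k _ => add_le_add (h1 k) (h2 k)
      _ = 3 * (W * E3 ^ (1 / 2 : ℝ)) * (∑ k, ∫⁻ ξ, g k ξ) + 3 * (3 * (W * E3 ^ (1 / 2 : ℝ)) * Em) := by
          rw [Finset.sum_add_distrib, Finset.mul_sum, Finset.sum_const, Finset.card_univ,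
            Fintype.card_fin, nsmul_eq_mul, Nat.cast_ofNat]
      _ = 12 * (W * E3 ^ (1 / 2 : ℝ)) * Em := by rw [hEm_sum]; ring
  have hfinal : ENNReal.ofReal |(∫ ξ, ∑ l, (((1 + ‖ξ‖) ^ m : ℝ) : ℂ) ^ 2 *
      (nonlin f f ξ l * conj (f ξ l))).re| ≤
      ENNReal.ofReal (commConst m * Real.sqrt (truncEnergy 3 R v) * truncEnergy m R v) := by
    refine hmain.trans ?_
    calc ENNReal.ofReal (2 * π) * (K * ∑ k, (X k * Y k * Vn1 + X k * Vw2 * Gn1 k))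
        ≤ ENNReal.ofReal (2 * π) * (K * (12 * (W * E3 ^ (1 / 2 : ℝ)) * Em)) := by gcongr
      _ = ENNReal.ofReal (commConst m * Real.sqrt (truncEnergy 3 R v) * truncEnergy m R v) := by
          rw [hK, hW, hE3, hEm, ← ofReal_weightConst, commConst,
            ENNReal.ofReal_rpow_of_nonneg (truncEnergy_nonneg 3 R v) (by norm_num : (0 : ℝ) ≤ 1 / 2),
            ← Real.sqrt_eq_rpow]
          have hK' : (m * 2 ^ (m - 1) : ℝ≥0∞) = ENNReal.ofReal (m * 2 ^ (m - 1) : ℝ) := by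
            rw [ENNReal.ofReal_mul (by positivity), ENNReal.ofReal_natCast, ENNReal.ofReal_pow (by norm_num),
              ENNReal.ofReal_ofNat]
          have h12 : (12 : ℝ≥0∞) = ENNReal.ofReal 12 := (ENNReal.ofReal_ofNat 12).symm
          rw [hK', h12]
          have hw := weightConst_nonneg
          have hs := Real.sqrt_nonneg (truncEnergy 3 R v)
          have he := truncEnergy_nonneg m R v
          rw [← ENNReal.ofReal_mul hw, ← ENNReal.ofReal_mul (by norm_num),
            ← ENNReal.ofReal_mul (by positivity), ← ENNReal.ofReal_mul (by positivity),
            ← ENNReal.ofReal_mul (by positivity)]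
          congr 1
          ring
  exact (ENNReal.ofReal_le_ofReal_iff (mul_nonneg (mul_nonneg (commConst_nonneg m)
    (Real.sqrt_nonneg _)) (truncEnergy_nonneg m R v))).1 hfinal

end Estimate

/-! ### A scalar comparison lemma -/

section Scalar

/-- The strict supersolution `p(t) = B/(1 − μt)²` of `p' = Λ p^{3/2}`: its derivative is
`2μB/(1 − μt)³`. [folklore] -/
theorem hasDerivAt_rational_supersolution {μ B t : ℝ} (h : 1 - μ * t ≠ 0) :
    HasDerivAt (fun t => B * ((1 - μ * t) ^ 2)⁻¹) (2 * μ * B / (1 - μ * t) ^ 3) t := by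
  have h1 : HasDerivAt (fun t => 1 - μ * t) (-(μ * 1)) t :=
    ((hasDerivAt_id' t).const_mul μ).const_sub 1
  have h2 := ((h1.fun_pow 2).fun_inv (pow_ne_zero 2 h)).const_mul B
  refine h2.congr_deriv ?_
  push_cast
  field_simp

/-- **Scalar comparison for `q' ≤ Λ q^{3/2}`**: if `q` is differentiable within `[0, T]` with
`q' ≤ Λ √q · q`, `q(0) ≤ A`, `A ≥ 0`, `Λ > 0` and `Λ (A+1)^{1/2} T ≤ ½`, then `q ≤ 4(A + 1)` on `[0, T]`:
`q` stays below the strict supersolution `(A+1)/(1 − μt)²`, `μ = Λ(A+1)^{1/2}`, by Mathlib's fencing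
theorem `image_le_of_deriv_right_lt_deriv_boundary'` (the comparison behind Majda–Bertozzi's
(3.59) ⟹ (3.60)). [cite: MajdaBertozzi2002, (3.59)-(3.60) p. 106] -/
theorem le_of_deriv_le_mul_sqrt_mul_self {q q' : ℝ → ℝ} {T Λ A : ℝ} (hΛ : 0 < Λ) (hA : 0 ≤ A)
    (hq : ∀ t ∈ Icc 0 T, HasDerivWithinAt q (q' t) (Icc 0 T) t)
    (hq' : ∀ t ∈ Icc 0 T, q' t ≤ Λ * Real.sqrt (q t) * q t) (h0 : q 0 ≤ A)
    (hT : Λ * Real.sqrt (A + 1) * T ≤ 1 / 2) : ∀ t ∈ Icc 0 T, q t ≤ 4 * (A + 1) := by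
  have hA1 : 0 < A + 1 := by linarith
  set σ : ℝ := Real.sqrt (A + 1) with hσ
  have hσ0 : 0 < σ := Real.sqrt_pos.2 hA1
  have hσsq : σ ^ 2 = A + 1 := Real.sq_sqrt hA1.le
  set μ : ℝ := Λ * σ with hμ
  have hμ0 : 0 < μ := mul_pos hΛ hσ0
  have hD : ∀ t ∈ Icc 0 T, 1 / 2 ≤ 1 - μ * t := fun t ht => by
    have : μ * t ≤ μ * T := mul_le_mul_of_nonneg_left ht.2 hμ0.le
    linarith
  set p : ℝ → ℝ := fun t => (A + 1) * ((1 - μ * t) ^ 2)⁻¹ with hp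
  set p' : ℝ → ℝ := fun t => 2 * μ * (A + 1) / (1 - μ * t) ^ 3 with hp'
  have hpt : ∀ t, p t = (A + 1) * ((1 - μ * t) ^ 2)⁻¹ := fun t => rfl
  have hp't : ∀ t, p' t = 2 * μ * (A + 1) / (1 - μ * t) ^ 3 := fun t => rfl
  have hpd : ∀ t ∈ Icc 0 T, HasDerivWithinAt p (p' t) (Icc 0 T) t := fun t ht =>
    (hasDerivAt_rational_supersolution (by linarith [hD t ht])).hasDerivWithinAt
  have hp0 : q 0 ≤ p 0 := by
    have : p 0 = A + 1 := by rw [hpt]; norm_num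
    rw [this]; linarith
  have hlt : ∀ t ∈ Icc 0 T, q t = p t → q' t < p' t := by
    intro t ht hqp
    have hDt : 0 < 1 - μ * t := by linarith [hD t ht]
    have hsq : Real.sqrt (p t) = σ / (1 - μ * t) := by
      rw [hpt, ← div_eq_mul_inv, Real.sqrt_div' _ (sq_nonneg _), Real.sqrt_sq hDt.le]
    have h1 : Λ * Real.sqrt (p t) * p t = μ * (A + 1) / (1 - μ * t) ^ 3 := by
      rw [hsq, hpt, hμ]
      field_simp
    have h2 : 0 < μ * (A + 1) / (1 - μ * t) ^ 3 := by positivity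
    have h3 : p' t = 2 * (μ * (A + 1) / (1 - μ * t) ^ 3) := by rw [hp't]; ring
    calc q' t ≤ Λ * Real.sqrt (q t) * q t := hq' t ht
      _ = μ * (A + 1) / (1 - μ * t) ^ 3 := by rw [hqp, h1]
      _ < p' t := by rw [h3]; linarith
  have hcomp : ∀ t ∈ Icc 0 T, q t ≤ p t := fun t ht =>
    image_le_of_deriv_right_lt_deriv_boundary' (fun t ht => (hq t ht).continuousWithinAt)
      (fun t ht => (hq t (Ico_subset_Icc_self ht)).mono_of_mem_nhdsWithin
        (Filter.mem_of_superset (Icc_mem_nhdsGE ht.2) (Icc_subset_Icc_left ht.1)))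
      hp0 (fun t ht => (hpd t ht).continuousWithinAt)
      (fun t ht => (hpd t (Ico_subset_Icc_self ht)).mono_of_mem_nhdsWithin
        (Filter.mem_of_superset (Icc_mem_nhdsGE ht.2) (Icc_subset_Icc_left ht.1)))
      (fun t ht => hlt t (Ico_subset_Icc_self ht)) ht
  intro t ht
  refine (hcomp t ht).trans ?_
  have hDt := hD t ht
  have h14 : 1 / 4 ≤ (1 - μ * t) ^ 2 := by nlinarith [hDt]
  rw [hpt, ← div_eq_mul_inv, div_le_iff₀ (by positivity)]
  calc A + 1 = 4 * (A + 1) * (1 / 4) := by ring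
    _ ≤ 4 * (A + 1) * (1 - μ * t) ^ 2 := by gcongr

end Scalar

/-! ### The differential inequalities along Galerkin solutions; lifespan and uniform bounds -/

section Apriori

variable {c R : ℝ} {m : ℕ}

/-- The rate constant `Λ'_m = 2Λ_m + 1 > 0` of the energy differential inequality. [folklore] -/
def energyRate (m : ℕ) : ℝ := 2 * commConst m + 1

/-- `Λ'_m > 0`. [folklore] -/
theorem energyRate_pos (m : ℕ) : 0 < energyRate m := by
  unfold energyRate; have := commConst_nonneg m; linarith

/-- **The energy identity along a Galerkin solution**:
`d/dt E_m^R(α) = 2 Re ⟪M_{θ_m} α, F_R(α)⟫` (one-sided at the endpoints). [folklore] -/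
theorem hasDerivWithinAt_truncEnergy_galerkin {s : Set ℝ} {α : ℝ → symSubspace} {t : ℝ}
    (hα : HasDerivWithinAt α (galerkinField c R (α t)) s t) :
    HasDerivWithinAt (fun τ => truncEnergy m R (α τ : 𝓗))
      (2 * (⟪energyCLM m R (α t : 𝓗), (galerkinField c R (α t) : 𝓗)⟫_ℂ).re) s t :=
  hasDerivWithinAt_truncEnergy (symSubspace.subtypeL.hasFDerivAt.comp_hasDerivWithinAt t hα)

/-- **The `H^m` differential inequality** (Majda–Bertozzi (3.58)–(3.59), Fourier side, uniform in
the cut-off and the viscosity): `d/dt E_m^R ≤ Λ'_m (E_3^R)^{1/2} E_m^R`, `m ≥ 1`, `c ≥ 0`.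
[cite: MajdaBertozzi2002, Prop. 3.7 (3.58) p. 105 and (3.59) p. 106] -/
theorem two_mul_re_inner_energyCLM_galerkinField_le (hc : 0 ≤ c) (hm : 1 ≤ m) (R : ℝ)
    (v : symSubspace) :
    2 * (⟪energyCLM m R (v : 𝓗), (galerkinField c R v : 𝓗)⟫_ℂ).re ≤
      energyRate m * Real.sqrt (truncEnergy 3 R (v : 𝓗)) * truncEnergy m R (v : 𝓗) := by
  have h1 := re_inner_energyCLM_galerkinField_le hc m R v
  have h2 := abs_re_inner_energyCLM_galerkinNonlin_le hm R v.2
  have h3 : 0 ≤ Real.sqrt (truncEnergy 3 R (v : 𝓗)) * truncEnergy m R (v : 𝓗) :=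
    mul_nonneg (Real.sqrt_nonneg _) (truncEnergy_nonneg m R _)
  unfold energyRate
  nlinarith

/-- **The uniform lifespan** `τ(A) = 1 / (2 Λ'_3 (A + 1)^{1/2})`, on which every Galerkin solution
with `E_3^R(0) ≤ A` keeps `E_3^R ≤ 4(A + 1)` (Majda–Bertozzi (3.55)/(3.60): `T < 1/(c_m‖v₀‖_m)`).
[cite: MajdaBertozzi2002, Thm. 3.4 (3.55) p. 104 and (3.60) p. 106] -/
def lifespan (A : ℝ) : ℝ := 1 / (2 * energyRate 3 * Real.sqrt (A + 1))

/-- `τ(A) > 0` for `A ≥ 0`. [folklore] -/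
theorem lifespan_pos {A : ℝ} (hA : 0 ≤ A) : 0 < lifespan A := by
  unfold lifespan
  have := energyRate_pos 3
  have : 0 < Real.sqrt (A + 1) := Real.sqrt_pos.2 (by linarith)
  positivity

/-- **Uniform `H³` bound on the lifespan** (Majda–Bertozzi 2002, (3.59)–(3.60), p. 106: from
`d/dt‖v^ε‖_m ≤ c_m‖v^ε‖²_m`, "for all `ε`, `sup_{0≤t≤T}‖v^ε‖_m ≤ ‖v₀‖_m/(1 − c_mT‖v₀‖_m)`"): for
`c ≥ 0`, a Galerkin solution on `[0, T]`, `T ≤ τ(A)`, with `E_3^R(α(0)) ≤ A` has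
`E_3^R(α(t)) ≤ 4(A + 1)` on `[0, T]` — uniformly in the cut-off radius `R` and in `c`. Proof:
comparison of `E_3^R` (`(E_3^R)' ≤ Λ'_3 (E_3^R)^{3/2}`) with the strict supersolution
`p(t) = (A+1)/(1 − μt)²`, `μ = Λ'_3(A+1)^{1/2}`, by Mathlib's fencing theorem
`image_le_of_deriv_right_lt_deriv_boundary'`. [cite: MajdaBertozzi2002, (3.59)-(3.60) p. 106] -/
theorem truncEnergy_three_le (hc : 0 ≤ c) {A T : ℝ} (hA : 0 ≤ A) (hT : T ≤ lifespan A)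
    {α : ℝ → symSubspace}
    (hα : ∀ t ∈ Icc 0 T, HasDerivWithinAt α (galerkinField c R (α t)) (Icc 0 T) t)
    (h0 : truncEnergy 3 R (α 0 : 𝓗) ≤ A) :
    ∀ t ∈ Icc 0 T, truncEnergy 3 R (α t : 𝓗) ≤ 4 * (A + 1) := by
  have hΛ := energyRate_pos 3
  refine le_of_deriv_le_mul_sqrt_mul_self hΛ hA
    (fun t ht => hasDerivWithinAt_truncEnergy_galerkin (hα t ht))
    (fun t _ => two_mul_re_inner_energyCLM_galerkinField_le hc (by norm_num) R (α t)) h0 ?_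
  have hσ : 0 < Real.sqrt (A + 1) := Real.sqrt_pos.2 (by linarith)
  have h1 : T ≤ 1 / (2 * energyRate 3 * Real.sqrt (A + 1)) := hT
  calc energyRate 3 * Real.sqrt (A + 1) * T
      ≤ energyRate 3 * Real.sqrt (A + 1) * (1 / (2 * energyRate 3 * Real.sqrt (A + 1))) := by gcongr
    _ = 1 / 2 := by field_simp

/-- **Uniform bounds for all weighted energies on the lifespan** (Majda–Bertozzi 2002, proof of
Thm. 3.6, p. 117: "(3.79) gives an a priori bound for `‖v(·,t)‖_m` for all `m ≥ 3`" on the `H³`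
interval; here at the Galerkin level, uniformly in `R` and `c`): for `m ≥ 1`,
`E_m^R(α(t)) ≤ E_m^R(α(0)) exp(2Λ'_m (A+1)^{1/2} t)` on `[0, T]`, `T ≤ τ(A)` — Grönwall on the
linear inequality `(E_m^R)' ≤ Λ'_m (E_3^R)^{1/2} E_m^R ≤ 2Λ'_m(A+1)^{1/2} E_m^R`.
[cite: MajdaBertozzi2002, (3.79) p. 116 with (3.58) p. 105] -/
theorem truncEnergy_le_mul_exp (hc : 0 ≤ c) (hm : 1 ≤ m) {A T : ℝ} (hA : 0 ≤ A) (hT : T ≤ lifespan A)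
    {α : ℝ → symSubspace}
    (hα : ∀ t ∈ Icc 0 T, HasDerivWithinAt α (galerkinField c R (α t)) (Icc 0 T) t)
    (h0 : truncEnergy 3 R (α 0 : 𝓗) ≤ A) :
    ∀ t ∈ Icc 0 T, truncEnergy m R (α t : 𝓗) ≤
      truncEnergy m R (α 0 : 𝓗) * Real.exp (energyRate m * (2 * Real.sqrt (A + 1)) * t) := by
  intro t ht
  set ψ : ℝ → ℝ := fun τ => truncEnergy m R (α τ : 𝓗) with hψ
  set ψ' : ℝ → ℝ := fun τ => 2 * (⟪energyCLM m R (α τ : 𝓗), (galerkinField c R (α τ) : 𝓗)⟫_ℂ).re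
    with hψ'
  set K : ℝ := energyRate m * (2 * Real.sqrt (A + 1)) with hK
  have hderiv : ∀ τ ∈ Icc 0 T, HasDerivWithinAt ψ (ψ' τ) (Icc 0 T) τ := fun τ hτ =>
    hasDerivWithinAt_truncEnergy_galerkin (hα τ hτ)
  have hcont : ContinuousOn ψ (Icc 0 T) := fun τ hτ => (hderiv τ hτ).continuousWithinAt
  have h3 := truncEnergy_three_le hc hA hT hα h0
  have hbound : ∀ τ ∈ Ico 0 T, ψ' τ ≤ K * ψ τ + 0 := by
    intro τ hτ
    have hτ' : τ ∈ Icc 0 T := Ico_subset_Icc_self hτ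
    have h1 := two_mul_re_inner_energyCLM_galerkinField_le hc hm R (α τ)
    have h2 : Real.sqrt (truncEnergy 3 R (α τ : 𝓗)) ≤ 2 * Real.sqrt (A + 1) := by
      calc Real.sqrt (truncEnergy 3 R (α τ : 𝓗)) ≤ Real.sqrt (4 * (A + 1)) := Real.sqrt_le_sqrt (h3 τ hτ')
        _ = 2 * Real.sqrt (A + 1) := by
            rw [Real.sqrt_mul (by norm_num), show (4 : ℝ) = 2 ^ 2 by norm_num,
              Real.sqrt_sq (by norm_num)]
    have he := truncEnergy_nonneg m R (α τ : 𝓗)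
    have hr := energyRate_pos m
    rw [add_zero, hK, hψ, hψ']
    calc 2 * (⟪energyCLM m R (α τ : 𝓗), (galerkinField c R (α τ) : 𝓗)⟫_ℂ).re
        ≤ energyRate m * Real.sqrt (truncEnergy 3 R (α τ : 𝓗)) * truncEnergy m R (α τ : 𝓗) := h1
      _ ≤ energyRate m * (2 * Real.sqrt (A + 1)) * truncEnergy m R (α τ : 𝓗) := by gcongr
  have hgron := le_gronwallBound_of_liminf_deriv_right_le (f := ψ) (f' := ψ') (δ := ψ 0) (K := K)
    (ε := 0) (a := 0) (b := T) hcont (fun τ hτ r hr => ?_) le_rfl hbound t ht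
  · rw [sub_zero, gronwallBound_ε0] at hgron
    exact hgron
  · have hmem_nhds : Icc 0 T ∈ 𝓝[Ici τ] τ :=
      mem_nhdsWithin.2 ⟨Iio T, isOpen_Iio, hτ.2, fun z hz => ⟨hτ.1.trans hz.2, hz.1.le⟩⟩
    exact ((hderiv τ (Ico_subset_Icc_self hτ)).mono_of_mem_nhdsWithin hmem_nhds)
      |>.liminf_right_slope_le hr

end Apriori

end Literature.Analysis.FluidPDE.FourierNS

end
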